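import Summits.AtomisticToContinuum.FouriersLaw.Theorems.VanishingNoiseTransferVanishingNoiseBoundFlipResolventTransposeMeasurable
import Summits.AtomisticToContinuum.FouriersLaw.Theorems.VanishingNoiseTransferVanishingNoiseBoundFlipWeakToClassical
import Summits.AtomisticToContinuum.FouriersLaw.Theorems.VanishingNoiseTransferVanishingNoiseBoundFlipMildForwardFieldTemps
import Summits.AtomisticToContinuum.FouriersLaw.Theorems.JunctionLocalitySuperadditiveResistanceDeviceGibbs
import Summits.AtomisticToContinuum.FouriersLaw.Theorems.BondHeatUncertaintySubdiffusiveBondHeatKernelGibbsE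
import Literature.MathematicalPhysics.KineticTheory.VelocityFlipNoise
import HarnessLib

/-!
# Mild forward fields of the flip-noisy generator are distributional solutions (dual Kubo road, glue)
(helper for stub `stub_flipFiniteResponse` of line `sector-dirichlet-gluing`,
crux `VanishingNoiseTransfer.NoisyFourier`, item stmt-AtomisticToContinuum-11977)

ROAD B of `stub_flipFiniteResponse` (`flipFiniteResponse_of_dualKuboRoad`, …NoisyFourierFlipFiniteResponseAux2)
consumes the `δ`-family of the dual Kubo road of the sister crux `VanishingNoiseBound`
(stmt-AtomisticToContinuum-11976): MEASURABLE, `e^{H/(4T)}`-bounded DISTRIBUTIONAL solutions `g` of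
`(L_{T_L,T_R} + εS) g = −(p_0² − T) + c` (tested against `C_c^∞` through the Lebesgue transpose
`−L + 2γ(T_L ∂²_{p_0} + T_R ∂²_{p_{L−1}}) + 2γ + εS`). What the tree PRODUCES (`flip_mildForwardField_exists_temps`,
…VanishingNoiseBoundFlipMildForwardFieldTemps) are MILD solutions: measurable `e^{H/(4T)}`-bounded `g` with
`g = R_r(r⁻¹(p_0² − T − c) + Q g)`, `r = Lε`, `R_r` the resolvent kernel of the flip-free Langevin semigroup at
`(T_L, T_R)` (`LangevinChainSemigroup.resolventKernel` of `pinnedChainSemigroup`), `Q g = L⁻¹ Σ_i g ∘ Θ_i` the flip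
average. This file is the glue (the content of the sister's registered stub `stub_flipMildDistributional`, proved
here under this crux's own name):

* `integrable_mul_of_abs_le_exp_of_hasCompactSupport` — measurable `e^{θH}`-bounded × continuous compactly
  supported is Lebesgue integrable;
* `flip_mildDistributional` — **mild ⇒ distributional.** Proof: the transposed resolvent identity for measurable
  exponentially bounded data `∫ (R_r h)(rφ − ᵀLφ) dx = r ∫ φ h dx` (`pinnedChain_integral_resolvent_mul_transpose`,
  …FlipResolventTransposeMeasurable) with `h = r⁻¹(p_0² − T − c) + Q g` (measurable, `e^{H/(4T)}`-bounded since
  `H ∘ Θ_i = H`), i.e. `r ∫ g φ − ∫ g ᵀLφ = ∫ (p_0² − T − c) φ + ε Σ_i ∫ φ (g ∘ Θ_i)`; the bridge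
  `ᵀLφ = −Lφ + 2γ(T_L ∂²_{p_0}φ + T_R ∂²_{p_{L−1}}φ) + 2γφ` (`revGenerator_eq_neg_generator_add'`,
  …FlipWeakToClassical); and `ε ∫ g Sφ = ε Σ_i ∫ g (φ ∘ Θ_i) − r ∫ g φ` with `∫ φ (g ∘ Θ_i) = ∫ (φ ∘ Θ_i) g`
  (`Θ_i` preserves Lebesgue measure, `integral_mul_comp_momentumFlip`).

References: Ethier–Kurtz 1986 Ch. 1 §2 (resolvent ⇒ generator); Bernardin–Olla 2011 §2.1.
-/

noncomputable section

namespace Summit.AtomisticToContinuum.FouriersLaw.Theorems.NoisyFourier.FlipFiniteResponse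

open MeasureTheory Filter Topology Set
open scoped ContDiff BigOperators
open Literature.MathematicalPhysics.KineticTheory
open Literature.MathematicalPhysics.KineticTheory.HeatConduction
open Literature.Probability.Process
open Summit.AtomisticToContinuum.FouriersLaw.Theorems.VanishingNoiseBound
open Summit.AtomisticToContinuum.FouriersLaw.Theorems.SubdiffusiveBondHeat (abs_sq_momentum_sub_le_exp)
open Summit.AtomisticToContinuum.FouriersLaw.Theorems.SuperadditiveResistance.DeviceLiouville (kin kin_eq_sq)

section Glue

variable {ω₂ lam β γ : ℝ}

/-- **Measurable `e^{θH}`-bounded × continuous compactly supported is integrable** (Lebesgue measure on phase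
space): a measurable `u` with `|u| ≤ C e^{θH}` is locally integrable (`H` is continuous). [folklore] -/
theorem integrable_mul_of_abs_le_exp_of_hasCompactSupport {L : ℕ} {θ C : ℝ} {u ψ : PhaseSpace L → ℝ}
    (hum : Measurable u) (hub : ∀ x, |u x| ≤ C * Real.exp (θ * (pinnedChain ω₂ lam β γ).hamiltonian L x))
    (hψ : Continuous ψ) (hψc : HasCompactSupport ψ) :
    Integrable (fun x => u x * ψ x) := by
  haveI := isAddHaarMeasure_volume_phaseSpace L
  have hBc : Continuous fun x => C * Real.exp (θ * (pinnedChain ω₂ lam β γ).hamiltonian L x) := by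
    have := pinnedChain_continuous_hamiltonian ω₂ lam β γ L
    fun_prop
  have hloc : LocallyIntegrable u volume :=
    hBc.locallyIntegrable.mono hum.aestronglyMeasurable (Eventually.of_forall fun x => by
      rw [Real.norm_eq_abs, Real.norm_eq_abs]; exact (hub x).trans (le_abs_self _))
  exact hloc.integrable_smul_right_of_hasCompactSupport hψ hψc

/-- `φ ∘ Θ_i` has compact support if `φ` has (`Θ_i = momentumFlip i` is a homeomorphism). [folklore] -/
theorem hasCompactSupport_comp_momentumFlip {L : ℕ} {φ : PhaseSpace L → ℝ} (hφc : HasCompactSupport φ)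
    (i : Fin L) : HasCompactSupport fun x => φ (momentumFlip i x) := by
  let e : PhaseSpace L ≃ₜ PhaseSpace L :=
    { toFun := momentumFlip i, invFun := momentumFlip i, left_inv := momentumFlip_momentumFlip i,
      right_inv := momentumFlip_momentumFlip i, continuous_toFun := continuous_momentumFlip i,
      continuous_invFun := continuous_momentumFlip i }
  exact hφc.comp_homeomorph e

/-- **Mild forward fields of `L_{T_L,T_R} + εS` are distributional solutions.** For the pinned chain (all
parameters `> 0`), `L ≥ 2`, `T, T_L, T_R > 0` with `1/(4T) < 1/max(T_L,T_R)`, `ε > 0`, a constant `c`, and a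
measurable `g` with `|g| ≤ C e^{H/(4T)}` solving the mild equation `g = R_{Lε}((Lε)⁻¹(p_0² − T − c) + L⁻¹Σ_i g∘Θ_i)`:
for every `φ ∈ C_c^∞`,
`∫ g · (−L_{T_L,T_R}φ + 2γ(T_L ∂²_{p_0}φ + T_R ∂²_{p_{L−1}}φ) + 2γφ + εSφ) dx = ∫ (−(p_0² − T) + c) φ dx`.
See the module docstring for the proof. [Ethier–Kurtz 1986, Ch. 1 §2] [folklore] -/
theorem flip_mildDistributional (hω : 0 < ω₂) (hl : 0 < lam) (hβ : 0 < β) (hγ : 0 < γ) {L : ℕ}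
    (hL : 2 ≤ L) {T T_L T_R : ℝ} (hT : 0 < T) (hTL : 0 < T_L) (hTR : 0 < T_R)
    (hθ' : 1 / (4 * T) < 1 / max T_L T_R) {ε : ℝ} (hε : 0 < ε) (c : ℝ) {g : PhaseSpace L → ℝ}
    (hgm : Measurable g)
    (hgb : ∃ C : ℝ, ∀ z, |g z| ≤ C * Real.exp (1 / (4 * T) * (pinnedChain ω₂ lam β γ).hamiltonian L z))
    (hmild : ∀ z, g z = ∫ y, (((L : ℝ) * ε)⁻¹ * ((y.2 ⟨0, by omega⟩ ^ 2 - T) - c) +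
        (L : ℝ)⁻¹ * ∑ i : Fin L, g (momentumFlip i y))
      ∂((pinnedChainSemigroup hω hl.le hβ.le hγ.le (by omega) hTL.le hTR.le).resolventKernel
        ((L : ℝ) * ε) z))
    {φ : PhaseSpace L → ℝ} (hφ : ContDiff ℝ ∞ φ) (hφc : HasCompactSupport φ) :
    ∫ x, g x * (-((pinnedChain ω₂ lam β γ).generator L T_L T_R φ x) +
        2 * γ * (T_L * partialP (⟨0, by omega⟩ : Fin L) (partialP (⟨0, by omega⟩ : Fin L) φ) x +
          T_R * partialP (⟨L - 1, by omega⟩ : Fin L) (partialP (⟨L - 1, by omega⟩ : Fin L) φ) x) +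
        2 * γ * φ x + ε * flipNoise L φ x) =
      ∫ x, (-(kin L 0 x - T) + c) * φ x := by
  haveI := isAddHaarMeasure_volume_phaseSpace L
  have hL1 : 1 < L := by omega
  have hL0 : 0 < L := by omega
  set P := pinnedChain ω₂ lam β γ with hP
  have hPγ : P.γ = γ := rfl
  have hLr : (L : ℝ) ≠ 0 := by exact_mod_cast hL0.ne'
  have hLpos : (0 : ℝ) < L := by exact_mod_cast hL0
  set r : ℝ := (L : ℝ) * ε with hr
  have hr0 : 0 < r := by positivity
  have hrL : r * (L : ℝ)⁻¹ = ε := by rw [hr]; field_simp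
  set θ : ℝ := 1 / (4 * T) with hθ
  have hθ0 : 0 < θ := by positivity
  set H : PhaseSpace L → ℝ := P.hamiltonian L with hH
  have hH0 : ∀ x, 0 ≤ H x := fun x => pinnedChain_hamiltonian_nonneg hω.le hl.le hβ.le γ L x
  have hHflip : ∀ (i : Fin L) (y : PhaseSpace L), H (momentumFlip i y) = H y := fun i y =>
    P.hamiltonian_momentumFlip i y
  obtain ⟨C, hC⟩ := hgb
  have hC0 : 0 ≤ C := nonneg_of_mul_nonneg_left ((abs_nonneg _).trans (hC 0)) (Real.exp_pos _)
  set i0 : Fin L := ⟨0, hL0⟩ with hi0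
  -- the source `h = r⁻¹ (p_0² − T − c) + Q g`
  set h : PhaseSpace L → ℝ := fun y => r⁻¹ * ((y.2 i0 ^ 2 - T) - c) +
    (L : ℝ)⁻¹ * ∑ i : Fin L, g (momentumFlip i y) with hh
  have hhm : Measurable h := by
    have h1 : Measurable fun y : PhaseSpace L => y.2 i0 ^ 2 :=
      ((measurable_pi_apply i0).comp measurable_snd).pow_const 2
    have h2 : Measurable fun y : PhaseSpace L => ∑ i : Fin L, g (momentumFlip i y) :=
      Finset.measurable_sum _ fun i _ => hgm.comp (measurable_momentumFlip i)
    rw [hh]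
    exact (measurable_const.mul ((h1.sub measurable_const).sub measurable_const)).add
      (measurable_const.mul h2)
  have hhb : ∀ y, |h y| ≤ (r⁻¹ * (2 / θ + T + |c|) + C) * Real.exp (θ * H y) := by
    intro y
    have e1 : 1 ≤ Real.exp (θ * H y) := Real.one_le_exp (mul_nonneg hθ0.le (hH0 y))
    have hk := abs_sq_momentum_sub_le_exp (γ := γ) hω hl.le hβ.le hθ0 hT.le y i0
    have hsum : |∑ i : Fin L, g (momentumFlip i y)| ≤ (L : ℝ) * (C * Real.exp (θ * H y)) := by
      calc |∑ i : Fin L, g (momentumFlip i y)| ≤ ∑ i : Fin L, |g (momentumFlip i y)| :=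
            Finset.abs_sum_le_sum_abs _ _
        _ ≤ ∑ _i : Fin L, C * Real.exp (θ * H y) := Finset.sum_le_sum fun i _ => by
            have := hC (momentumFlip i y)
            rwa [hHflip i y] at this
        _ = (L : ℝ) * (C * Real.exp (θ * H y)) := by
            rw [Finset.sum_const, Finset.card_univ, Fintype.card_fin, nsmul_eq_mul]
    have hk' : |(y.2 i0 ^ 2 - T) - c| ≤ (2 / θ + T) * Real.exp (θ * H y) + |c| * Real.exp (θ * H y) :=
      (abs_sub _ _).trans (add_le_add hk (le_mul_of_one_le_right (abs_nonneg _) e1))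
    calc |h y| ≤ |r⁻¹ * ((y.2 i0 ^ 2 - T) - c)| + |(L : ℝ)⁻¹ * ∑ i : Fin L, g (momentumFlip i y)| :=
          abs_add_le _ _
      _ = r⁻¹ * |(y.2 i0 ^ 2 - T) - c| + (L : ℝ)⁻¹ * |∑ i : Fin L, g (momentumFlip i y)| := by
          rw [abs_mul, abs_mul, abs_of_pos (inv_pos.2 hr0), abs_of_pos (inv_pos.2 hLpos)]
      _ ≤ r⁻¹ * ((2 / θ + T) * Real.exp (θ * H y) + |c| * Real.exp (θ * H y)) +
            (L : ℝ)⁻¹ * ((L : ℝ) * (C * Real.exp (θ * H y))) :=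
          add_le_add (mul_le_mul_of_nonneg_left hk' (inv_pos.2 hr0).le)
            (mul_le_mul_of_nonneg_left hsum (inv_pos.2 hLpos).le)
      _ = (r⁻¹ * (2 / θ + T + |c|) + C) * Real.exp (θ * H y) := by
          rw [inv_mul_cancel_left₀ hLr]
          ring
  -- the transposed resolvent identity for `h`, with `R_r h = g`
  have key := pinnedChain_integral_resolvent_mul_transpose hω hl hβ hγ hL1 hTL hTR hr0 hθ0 hθ' hφ hφc hhm hhb
  have hg' : ∀ x, (∫ y, h y ∂((pinnedChainSemigroup hω hl.le hβ.le hγ.le (Nat.zero_lt_of_lt hL1) hTL.le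
      hTR.le).resolventKernel r x)) = g x := fun x => (hmild x).symm
  simp only [hg'] at key
  -- the Lebesgue transpose `ᵀLφ` and the bridge to the stated form
  have hU : ContDiff ℝ ∞ P.U := pinnedChain_contDiff_U ω₂ lam β γ
  have hV : ContDiff ℝ ∞ P.V := pinnedChain_contDiff_V ω₂ lam β γ
  have hφ2 : ContDiff ℝ 2 φ := hφ.of_le (by norm_cast)
  have hφc' : Continuous φ := hφ.continuous
  set TL : PhaseSpace L → ℝ := fun x => sdeGenerator (fun y => -P.drift L y) (P.bathVecL L T_L)
    (P.bathVecR L T_R) φ x + 2 * γ * φ x with hTL_def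
  have hTLc : Continuous TL :=
    (continuous_sdeGenerator _ _ (P.contDiff_drift hU hV L).continuous.neg hφ2).add
      (continuous_const.mul hφc')
  have hTLs : HasCompactSupport TL := (hasCompactSupport_sdeGenerator _ _ hφc).add hφc.mul_left
  have hγL : 0 ≤ P.γ * T_L := by rw [hPγ]; positivity
  have hγR : 0 ≤ P.γ * T_R := by rw [hPγ]; positivity
  have hbridge : ∀ x, -(P.generator L T_L T_R φ x) +
      2 * γ * (T_L * partialP (⟨0, by omega⟩ : Fin L) (partialP (⟨0, by omega⟩ : Fin L) φ) x +
        T_R * partialP (⟨L - 1, by omega⟩ : Fin L) (partialP (⟨L - 1, by omega⟩ : Fin L) φ) x) +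
      2 * γ * φ x = TL x := by
    intro x
    have hb := revGenerator_eq_neg_generator_add' P hL0 hγL hγR hφ2 x
    rw [hPγ] at hb
    rw [hTL_def]
    dsimp only
    rw [hb]
  -- integrability of all the pairings
  have hφF : ∀ i : Fin L, Continuous fun x => φ (momentumFlip i x) := fun i =>
    hφc'.comp (continuous_momentumFlip i)
  have hφFc : ∀ i : Fin L, HasCompactSupport fun x => φ (momentumFlip i x) := fun i =>
    hasCompactSupport_comp_momentumFlip hφc i
  have iGφ : Integrable (fun x => g x * φ x) := integrable_mul_of_abs_le_exp_of_hasCompactSupport hgm hC hφc' hφc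
  have iGT : Integrable (fun x => g x * TL x) := integrable_mul_of_abs_le_exp_of_hasCompactSupport hgm hC hTLc hTLs
  have iGF : ∀ i : Fin L, Integrable (fun x => g x * φ (momentumFlip i x)) := fun i =>
    integrable_mul_of_abs_le_exp_of_hasCompactSupport hgm hC (hφF i) (hφFc i)
  have iGFφ : ∀ i : Fin L, Integrable (fun x => g (momentumFlip i x) * φ x) := by
    intro i
    have h1 := (integrable_comp_momentumFlip_iff (measurePreserving_momentumFlip_volume i)).2 (iGF i)
    simpa only [momentumFlip_momentumFlip] using h1
  have iHφ : Integrable (fun x => h x * φ x) := integrable_mul_of_abs_le_exp_of_hasCompactSupport hhm hhb hφc' hφc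
  have iKφ : Integrable (fun x => ((x.2 i0 ^ 2 - T) - c) * φ x) :=
    ((by fun_prop : Continuous fun x : PhaseSpace L => (x.2 i0 ^ 2 - T) - c).mul hφc').integrable_of_hasCompactSupport
      hφc.mul_left
  -- (1) the left-hand side, integrated
  have hS : ∀ x, flipNoise L φ x = ∑ i : Fin L, φ (momentumFlip i x) - (L : ℝ) * φ x := by
    intro x
    rw [flipNoise_eq, Finset.sum_sub_distrib, Finset.sum_const, Finset.card_univ, Fintype.card_fin, nsmul_eq_mul]
  have eL : ∀ x, g x * (-(P.generator L T_L T_R φ x) +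
      2 * γ * (T_L * partialP (⟨0, by omega⟩ : Fin L) (partialP (⟨0, by omega⟩ : Fin L) φ) x +
        T_R * partialP (⟨L - 1, by omega⟩ : Fin L) (partialP (⟨L - 1, by omega⟩ : Fin L) φ) x) +
      2 * γ * φ x + ε * flipNoise L φ x) =
      g x * TL x + ε * (∑ i : Fin L, g x * φ (momentumFlip i x)) - r * (g x * φ x) := by
    intro x
    rw [← hbridge x, hS x, ← Finset.mul_sum, hr]
    ring
  have hLHS : ∫ x, g x * (-(P.generator L T_L T_R φ x) +
      2 * γ * (T_L * partialP (⟨0, by omega⟩ : Fin L) (partialP (⟨0, by omega⟩ : Fin L) φ) x +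
        T_R * partialP (⟨L - 1, by omega⟩ : Fin L) (partialP (⟨L - 1, by omega⟩ : Fin L) φ) x) +
      2 * γ * φ x + ε * flipNoise L φ x) =
      (∫ x, g x * TL x) + ε * (∑ i : Fin L, ∫ x, g x * φ (momentumFlip i x)) - r * ∫ x, g x * φ x := by
    have iS : Integrable (fun x => ∑ i : Fin L, g x * φ (momentumFlip i x)) :=
      integrable_finsetSum _ fun i _ => iGF i
    have i1 : Integrable (fun x => g x * TL x + ε * ∑ i : Fin L, g x * φ (momentumFlip i x)) :=
      iGT.add (iS.const_mul ε)
    rw [integral_congr_ae (ae_of_all _ eL), integral_sub i1 (iGφ.const_mul r),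
      integral_add iGT (iS.const_mul ε), integral_const_mul, integral_const_mul,
      integral_finsetSum _ fun i _ => iGF i]
  -- (2) the transposed resolvent identity, expanded
  have k1 : ∫ x, g x * (r * φ x - TL x) = r * (∫ x, g x * φ x) - ∫ x, g x * TL x := by
    have e : ∀ x, g x * (r * φ x - TL x) = r * (g x * φ x) - g x * TL x := fun x => by ring
    rw [integral_congr_ae (ae_of_all _ e), integral_sub (iGφ.const_mul r) iGT, integral_const_mul]
  have k3 : ∀ i : Fin L, ∫ x, g (momentumFlip i x) * φ x = ∫ x, g x * φ (momentumFlip i x) := fun i =>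
    (integral_mul_comp_momentumFlip (measurePreserving_momentumFlip_volume i) φ g).symm
  have k2 : r * ∫ x, φ x * h x =
      (∫ x, ((x.2 i0 ^ 2 - T) - c) * φ x) + ε * ∑ i : Fin L, ∫ x, g x * φ (momentumFlip i x) := by
    have e : ∀ x, φ x * h x =
        r⁻¹ * (((x.2 i0 ^ 2 - T) - c) * φ x) + (L : ℝ)⁻¹ * ∑ i : Fin L, g (momentumFlip i x) * φ x := by
      intro x
      rw [hh]
      dsimp only
      rw [← Finset.sum_mul]
      ring
    have iS : Integrable (fun x => ∑ i : Fin L, g (momentumFlip i x) * φ x) :=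
      integrable_finsetSum _ fun i _ => iGFφ i
    rw [integral_congr_ae (ae_of_all _ e), integral_add (iKφ.const_mul _) (iS.const_mul _), integral_const_mul,
      integral_const_mul, integral_finsetSum _ (fun i _ => iGFφ i), mul_add, ← mul_assoc, mul_inv_cancel₀ hr0.ne',
      one_mul, ← mul_assoc, hrL]
    simp only [k3]
  -- (3) the right-hand side
  have k4 : ∫ x, (-(kin L 0 x - T) + c) * φ x = -∫ x, ((x.2 i0 ^ 2 - T) - c) * φ x := by
    rw [← integral_neg]
    refine integral_congr_ae (ae_of_all _ fun x => ?_)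
    dsimp only
    rw [kin_eq_sq hL0]
    ring
  -- (4) assemble
  rw [k1, k2] at key
  rw [hLHS, k4]
  linarith [key]

/-- **The centred mild forward field of the unique flip steady state is a distributional forward field.** For the
pinned chain (all parameters `> 0`), `L ≥ 2`, `T, T_L, T_R > 0` with `1/(4T) < 1/max(T_L,T_R)`, `ε > 0` and the
unique weak flip steady state `μ` at `(T_L, T_R)`: there is a measurable `g` with `|g| ≤ C e^{H/(4T)}` solving
BOTH the centred mild equation `g = R_{Lε}((Lε)⁻¹(p_0² − T − μ(p_0² − T)) + L⁻¹Σ_i g∘Θ_i)`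
(`flip_mildForwardField_exists_temps`, …VanishingNoiseBoundFlipMildForwardFieldTemps) AND the distributional
equation `(L_{T_L,T_R} + εS) g = −(p_0² − T) + μ(p_0² − T)` in `𝓓'` (`flip_mildDistributional`), the centring
written with `kin L 0 = p_0²` as in the dual Kubo road. [Bernardin–Olla 2011, §2.1] [folklore] -/
theorem flip_distributionalForwardField_exists_temps (hω : 0 < ω₂) (hl : 0 < lam) (hβ : 0 < β) (hγ : 0 < γ)
    {L : ℕ} (hL : 2 ≤ L) {T T_L T_R : ℝ} (hT : 0 < T) (hTL : 0 < T_L) (hTR : 0 < T_R)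
    (hθ' : 1 / (4 * T) < 1 / max T_L T_R) {ε : ℝ} (hε : 0 < ε) {μ : Measure (PhaseSpace L)}
    (hμ : (pinnedChain ω₂ lam β γ).IsFlipSteadyState L T_L T_R ε μ ∧
      ∀ ν : Measure (PhaseSpace L), (pinnedChain ω₂ lam β γ).IsFlipSteadyState L T_L T_R ε ν → ν = μ) :
    ∃ g : PhaseSpace L → ℝ, Measurable g ∧
      (∃ C : ℝ, ∀ z, |g z| ≤ C * Real.exp (1 / (4 * T) * (pinnedChain ω₂ lam β γ).hamiltonian L z)) ∧
      (∀ z, g z = ∫ y, (((L : ℝ) * ε)⁻¹ * ((y.2 ⟨0, by omega⟩ ^ 2 - T) - ∫ w, (kin L 0 w - T) ∂μ) +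
          (L : ℝ)⁻¹ * ∑ i : Fin L, g (momentumFlip i y))
        ∂((pinnedChainSemigroup hω hl.le hβ.le hγ.le (by omega) hTL.le hTR.le).resolventKernel
          ((L : ℝ) * ε) z)) ∧
      ∀ φ : PhaseSpace L → ℝ, ContDiff ℝ ∞ φ → HasCompactSupport φ →
        ∫ x, g x * (-((pinnedChain ω₂ lam β γ).generator L T_L T_R φ x) +
            2 * γ * (T_L * partialP (⟨0, by omega⟩ : Fin L) (partialP (⟨0, by omega⟩ : Fin L) φ) x +
              T_R * partialP (⟨L - 1, by omega⟩ : Fin L) (partialP (⟨L - 1, by omega⟩ : Fin L) φ) x) +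
            2 * γ * φ x + ε * flipNoise L φ x) =
          ∫ x, (-(kin L 0 x - T) + ∫ y, (kin L 0 y - T) ∂μ) * φ x := by
  obtain ⟨g, hgm, hgb, hmild⟩ :=
    flip_mildForwardField_exists_temps hω hl hβ hγ (by omega : 1 < L) hT hTL hTR hθ' hε hμ
  have hc : ∫ w, (kin L 0 w - T) ∂μ = ∫ w, (w.2 ⟨0, by omega⟩ ^ 2 - T) ∂μ :=
    integral_congr_ae (ae_of_all _ fun w => by simp only [kin_eq_sq (by omega : 0 < L) w])
  refine ⟨g, hgm, hgb, fun z => ?_, fun φ hφ hφc => ?_⟩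
  · rw [hc]; exact hmild z
  · rw [hc]
    exact flip_mildDistributional hω hl hβ hγ hL hT hTL hTR hθ' hε _ hgm hgb hmild hφ hφc

/-- **The `δ`-family of distributional mild forward fields of the unique flip-steady family.** For the pinned chain
(all parameters `> 0`), `L ≥ 2`, `T > 0`, `ε > 0` and the unique flip-steady family `μ T_L T_R` at length `L`:
there is `g : ℝ → (PhaseSpace L → ℝ)` such that for every bias `δ` with `T ± δ/2 > 0` the field `g δ` is
measurable, `e^{H/(4T)}`-bounded, solves the centred mild equation at temperatures `T ± δ/2` with the centring
`c_δ = ∫ (p_0² − T) dμ_δ` of the dual Kubo road, and is a distributional solution of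
`(L_{T+δ/2,T−δ/2} + εS) g_δ = −(p_0² − T) + c_δ` (`flip_distributionalForwardField_exists_temps` for each `δ`;
`1/(4T) < 1/max(T ± δ/2)` because `|δ| < 2T`). This is the input family of the continuity stub CONT and of the
clauses "bounds" and "measurable + distributional" of the dual-road hypothesis of stmt-AtomisticToContinuum-11976.
[Bernardin–Olla 2011, §2.1] [folklore] -/
theorem flip_distributionalForwardFamily_exists (hω : 0 < ω₂) (hl : 0 < lam) (hβ : 0 < β) (hγ : 0 < γ)
    {L : ℕ} (hL : 2 ≤ L) {T : ℝ} (hT : 0 < T) {ε : ℝ} (hε : 0 < ε) {μ : ℝ → ℝ → Measure (PhaseSpace L)}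
    (hμ : ∀ T_L T_R : ℝ, 0 < T_L → 0 < T_R →
      (pinnedChain ω₂ lam β γ).IsFlipSteadyState L T_L T_R ε (μ T_L T_R) ∧
        ∀ ν : Measure (PhaseSpace L), (pinnedChain ω₂ lam β γ).IsFlipSteadyState L T_L T_R ε ν → ν = μ T_L T_R) :
    ∃ g : ℝ → PhaseSpace L → ℝ, ∀ (δ : ℝ) (hTL : 0 < T + δ / 2) (hTR : 0 < T - δ / 2),
      Measurable (g δ) ∧
      (∃ C : ℝ, ∀ z, |g δ z| ≤ C * Real.exp (1 / (4 * T) * (pinnedChain ω₂ lam β γ).hamiltonian L z)) ∧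
      (∀ z, g δ z = ∫ y, (((L : ℝ) * ε)⁻¹ * ((y.2 ⟨0, by omega⟩ ^ 2 - T) -
            ∫ w, (kin L 0 w - T) ∂(μ (T + δ / 2) (T - δ / 2))) + (L : ℝ)⁻¹ * ∑ i : Fin L, g δ (momentumFlip i y))
        ∂((pinnedChainSemigroup hω hl.le hβ.le hγ.le (by omega) hTL.le hTR.le).resolventKernel
          ((L : ℝ) * ε) z)) ∧
      ∀ φ : PhaseSpace L → ℝ, ContDiff ℝ ∞ φ → HasCompactSupport φ →
        ∫ x, g δ x * (-((pinnedChain ω₂ lam β γ).generator L (T + δ / 2) (T - δ / 2) φ x) +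
            2 * γ * ((T + δ / 2) * partialP (⟨0, by omega⟩ : Fin L) (partialP (⟨0, by omega⟩ : Fin L) φ) x +
              (T - δ / 2) * partialP (⟨L - 1, by omega⟩ : Fin L) (partialP (⟨L - 1, by omega⟩ : Fin L) φ) x) +
            2 * γ * φ x + ε * flipNoise L φ x) =
          ∫ x, (-(kin L 0 x - T) + ∫ y, (kin L 0 y - T) ∂(μ (T + δ / 2) (T - δ / 2))) * φ x := by
  classical
  -- temperatures `T ± δ/2 > 0` force `1/(4T) < 1/max(T + δ/2, T − δ/2)`
  have hθ' : ∀ δ : ℝ, 0 < T + δ / 2 → 0 < T - δ / 2 → 1 / (4 * T) < 1 / max (T + δ / 2) (T - δ / 2) := by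
    intro δ h1 h2
    have hm : 0 < max (T + δ / 2) (T - δ / 2) := lt_max_of_lt_left h1
    have hlt : max (T + δ / 2) (T - δ / 2) < 4 * T := max_lt (by linarith) (by linarith)
    exact one_div_lt_one_div_of_lt hm hlt
  have hex : ∀ δ : ℝ, ∀ h : 0 < T + δ / 2 ∧ 0 < T - δ / 2, ∃ g : PhaseSpace L → ℝ, Measurable g ∧
      (∃ C : ℝ, ∀ z, |g z| ≤ C * Real.exp (1 / (4 * T) * (pinnedChain ω₂ lam β γ).hamiltonian L z)) ∧
      (∀ z, g z = ∫ y, (((L : ℝ) * ε)⁻¹ * ((y.2 ⟨0, by omega⟩ ^ 2 - T) -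
            ∫ w, (kin L 0 w - T) ∂(μ (T + δ / 2) (T - δ / 2))) + (L : ℝ)⁻¹ * ∑ i : Fin L, g (momentumFlip i y))
        ∂((pinnedChainSemigroup hω hl.le hβ.le hγ.le (by omega) h.1.le h.2.le).resolventKernel
          ((L : ℝ) * ε) z)) ∧
      ∀ φ : PhaseSpace L → ℝ, ContDiff ℝ ∞ φ → HasCompactSupport φ →
        ∫ x, g x * (-((pinnedChain ω₂ lam β γ).generator L (T + δ / 2) (T - δ / 2) φ x) +
            2 * γ * ((T + δ / 2) * partialP (⟨0, by omega⟩ : Fin L) (partialP (⟨0, by omega⟩ : Fin L) φ) x +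
              (T - δ / 2) * partialP (⟨L - 1, by omega⟩ : Fin L) (partialP (⟨L - 1, by omega⟩ : Fin L) φ) x) +
            2 * γ * φ x + ε * flipNoise L φ x) =
          ∫ x, (-(kin L 0 x - T) + ∫ y, (kin L 0 y - T) ∂(μ (T + δ / 2) (T - δ / 2))) * φ x :=
    fun δ h => flip_distributionalForwardField_exists_temps hω hl hβ hγ hL hT h.1 h.2 (hθ' δ h.1 h.2) hε
      (hμ _ _ h.1 h.2)
  choose g hg using hex
  refine ⟨fun δ => if h : 0 < T + δ / 2 ∧ 0 < T - δ / 2 then g δ h else 0, fun δ hTL hTR => ?_⟩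
  have hpos : 0 < T + δ / 2 ∧ 0 < T - δ / 2 := ⟨hTL, hTR⟩
  simp only [dif_pos hpos]
  exact hg δ hpos

end Glue

/-! ## Registered helper -/

/-- Registered helper sub-goal `helper_flipFiniteResponseMildDistributional` of stub `stub_flipFiniteResponse`
(line `sector-dirichlet-gluing`, crux stmt-AtomisticToContinuum-11977): mild forward fields of `L_{T_L,T_R} + εS`
are distributional solutions (`flip_mildDistributional`, notation-free restatement; the same statement as the
registered stub `stub_flipMildDistributional` of the sister crux stmt-AtomisticToContinuum-11976, here under this
crux's namespace). [folklore] -/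
theorem helper_flipFiniteResponseMildDistributional : ∀ (ω₂ lam β γ : ℝ) (hω : 0 < ω₂) (hl : 0 < lam) (hβ : 0 < β) (hγ : 0 < γ) (L : ℕ) (hL : 2 ≤ L) (T T_L T_R : ℝ) (hT : 0 < T) (hTL : 0 < T_L) (hTR : 0 < T_R), 1 / (4 * T) < 1 / max T_L T_R → ∀ (ε : ℝ), 0 < ε → ∀ (c : ℝ) (g : Literature.MathematicalPhysics.KineticTheory.HeatConduction.PhaseSpace L → ℝ), Measurable g → (∃ C : ℝ, ∀ z, |g z| ≤ C * Real.exp (1 / (4 * T) * (Literature.MathematicalPhysics.KineticTheory.HeatConduction.pinnedChain ω₂ lam β γ).hamiltonian L z)) → (∀ z, g z = ∫ y, (((L : ℝ) * ε)⁻¹ * ((y.2 ⟨0, by omega⟩ ^ 2 - T) - c) + (L : ℝ)⁻¹ * ∑ i : Fin L, g (Literature.MathematicalPhysics.KineticTheory.HeatConduction.momentumFlip i y)) ∂((Literature.MathematicalPhysics.KineticTheory.HeatConduction.pinnedChainSemigroup hω hl.le hβ.le hγ.le (by omega) hTL.le hTR.le).resolventKernel ((L : ℝ) * ε) z)) → ∀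 φ : Literature.MathematicalPhysics.KineticTheory.HeatConduction.PhaseSpace L → ℝ, ContDiff ℝ ((⊤ : ℕ∞) : WithTop ℕ∞) φ → HasCompactSupport φ → ∫ x, g x * (-((Literature.MathematicalPhysics.KineticTheory.HeatConduction.pinnedChain ω₂ lam β γ).generator L T_L T_R φ x) + 2 * γ * (T_L * Literature.MathematicalPhysics.KineticTheory.HeatConduction.partialP (⟨0, by omega⟩ : Fin L) (Literature.MathematicalPhysics.KineticTheory.HeatConduction.partialP (⟨0, by omega⟩ : Fin L) φ) x + T_R * Literature.MathematicalPhysics.KineticTheory.HeatConduction.partialP (⟨L - 1, by omega⟩ : Fin L) (Literature.MathematicalPhysics.KineticTheory.HeatConduction.partialP (⟨L - 1, by omega⟩ : Fin L) φ) x) + 2 * γ * φ x + ε * Literature.MathematicalPhysics.KineticTheory.HeatConduction.flipNoise L φ x) = ∫ x, (-(Summit.AtomisticToContinuum.FouriersLaw.Theorems.SuperadditiveResistance.DeviceLiouville.kin L 0 x - T) + c) * φ x :=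
  fun _ _ _ _ hω hl hβ hγ _ hL _ _ _ hT hTL hTR hθ' _ hε c _ hgm hgb hmild _ hφ hφc =>
    flip_mildDistributional hω hl hβ hγ hL hT hTL hTR hθ' hε c hgm hgb hmild hφ hφc

end Summit.AtomisticToContinuum.FouriersLaw.Theorems.NoisyFourier.FlipFiniteResponse

end
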